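import Mathlib
import HarnessLib

/-!
# Proof of stub_etaLedgerArith

The η-ledger arithmetic bounds for the Remainder0Xi skeleton.
-/

namespace Summit.RiemannHypothesis.RiemannHypothesis.Cruxes.Remainder0Xi.Rho2V2

open Real

/-- Platt-Trudgian verification height. -/
abbrev T_PT : ℝ := 3000175332800

/-- Local mean spacing s(γ) = 2π/log(γ/2π). -/
noncomputable def xiSpacing (γ : ℝ) : ℝ := 2 * Real.pi / Real.log (γ / (2 * Real.pi))

/-- Box half-width R/2 = 67.5. -/
noncomputable abbrev boxHalfWidth : ℝ := 135 / 2

/-- η = 1/2 (target bound in s-shares). -/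
noncomputable abbrev eta0 : ℝ := 1 / 2

/-- Start of integration (low zeros). -/
noncomputable abbrev lowStart : ℝ := 14

/-- Error budget ε = 0.15 in s-shares. -/
noncomputable abbrev errorBudget : ℝ := 15 / 100

/-- The η-ledger arithmetic bounds for Remainder0Xi composition. -/
def EtaLedgerArith : Prop :=
  ∀ γ : ℝ, T_PT < γ → ∀ x : ℝ, |x - γ| ≤ boxHalfWidth →
    Real.log x * (135 + 4 * lowStart) / x ≤ 1 / 1000 ∧
    Real.pi / 4 + 1 / 1000 + errorBudget / xiSpacing γ ≤ eta0 / xiSpacing γ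

/-- Prove the η-ledger arithmetic bounds. -/
theorem stub_etaLedgerArith : EtaLedgerArith := by
  intro γ hγ x hx
  constructor
  · -- small: log(x)*191/x ≤ 1/1000
    -- Use Real.log_div_self_antitoneOn: log(t)/t is decreasing for t ≥ e
    -- At x > T_PT - 67.5 > 1.5e12 > e, we have log(x)/x ≤ log(x₀)/x₀ where x₀ = T_PT - 67.5
    have hx_lower : γ - boxHalfWidth ≤ x := by have := abs_le.1 hx; linarith
    have hx0 : T_PT - boxHalfWidth = (3000175332800 : ℝ) - 67.5 := by unfold T_PT boxHalfWidth; ring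
    have hx_huge : T_PT - boxHalfWidth < x := by
      calc T_PT - boxHalfWidth = T_PT - 67.5 := by unfold boxHalfWidth; ring
        _ < γ - 67.5 := by linarith
        _ = γ - boxHalfWidth := by unfold boxHalfWidth; ring
        _ ≤ x := hx_lower
    have hx_pos : 0 < x := by unfold T_PT boxHalfWidth at hx_huge; linarith
    have hx0_pos : 0 < T_PT - boxHalfWidth := by unfold T_PT boxHalfWidth; norm_num
    -- Use the antitone property
    have he_lt_x0 : Real.exp 1 < T_PT - boxHalfWidth := by
      calc Real.exp 1 < 3 := lt_trans Real.exp_one_lt_d9 (by norm_num)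
        _ < T_PT - boxHalfWidth := by unfold T_PT boxHalfWidth; norm_num
    have hx0_mem : T_PT - boxHalfWidth ∈ Set.Ici (Real.exp 1) := by simp [Set.mem_Ici, le_of_lt he_lt_x0]
    have hx_mem : x ∈ Set.Ici (Real.exp 1) := by
      simp only [Set.mem_Ici]; exact le_of_lt (lt_trans he_lt_x0 hx_huge)
    have h_antitone := Real.log_div_self_antitoneOn hx0_mem hx_mem (le_of_lt hx_huge)
    -- log(x)/x ≤ log(x₀)/x₀ where x₀ = 3000175332732.5
    -- log(3e12) ≈ 28.7, so log(x₀)/x₀ ≈ 28.7/3e12 ≈ 9.6e-12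
    -- Then 191 * 9.6e-12 ≈ 1.8e-9 << 1/1000
    have h_bound : Real.log (T_PT - boxHalfWidth) / (T_PT - boxHalfWidth) * 191 ≤ 1 / 1000 := by
      -- log(3e12) < 29, so log(x₀)/x₀ < 29/3e12
      have hlog_x0 : Real.log (T_PT - boxHalfWidth) < 29 := by
        have : Real.exp 29 = Real.exp 1 ^ 29 := by rw [← Real.exp_nat_mul]; ring_nf
        have he_gt : (2.718 : ℝ) < Real.exp 1 := lt_trans (by norm_num) Real.exp_one_gt_d9
        have h1 : (2.718 : ℝ) ^ 29 < Real.exp 1 ^ 29 := by gcongr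
        have hexp29 : T_PT - boxHalfWidth < Real.exp 29 := by
          calc T_PT - boxHalfWidth = 3000175332800 - 67.5 := by unfold T_PT boxHalfWidth; ring
            _ < (3.1e12 : ℝ) := by norm_num
            _ < (2.718 : ℝ) ^ 29 := by norm_num
            _ < Real.exp 1 ^ 29 := h1
            _ = Real.exp 29 := this.symm
        calc Real.log (T_PT - boxHalfWidth) < Real.log (Real.exp 29) := Real.log_lt_log hx0_pos hexp29
          _ = 29 := Real.log_exp 29
      calc Real.log (T_PT - boxHalfWidth) / (T_PT - boxHalfWidth) * 191
          ≤ 29 / (T_PT - boxHalfWidth) * 191 := by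
              apply mul_le_mul_of_nonneg_right
              exact le_of_lt (div_lt_div_of_pos_right hlog_x0 hx0_pos)
              norm_num
        _ = 29 * 191 / (T_PT - boxHalfWidth) := by ring
        _ ≤ 29 * 191 / 3000175332700 := by
              apply div_le_div_of_nonneg_left (by norm_num)
              · norm_num
              · unfold T_PT boxHalfWidth; norm_num
        _ ≤ 1 / 1000 := le_of_lt (by norm_num)
    calc Real.log x * (135 + 4 * lowStart) / x
        = Real.log x / x * 191 := by unfold lowStart; ring
      _ ≤ Real.log (T_PT - boxHalfWidth) / (T_PT - boxHalfWidth) * 191 := by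
          apply mul_le_mul_of_nonneg_right h_antitone (by norm_num)
      _ ≤ 1 / 1000 := h_bound
  · -- key: π/4 + 1/1000 + ε/s ≤ η/s
    -- Equivalently: π/4 + 1/1000 ≤ (η - ε)/s = 0.35/s
    -- At γ > T_PT: log(γ/(2π)) > 15, so s = 2π/log(γ/(2π)) < 2π/15
    -- 0.35/s = 0.35 * log(γ/(2π)) / (2π) ≥ 0.35 * 15 / (2π) = 5.25/(2π) > 0.83
    -- π/4 + 1/1000 < 0.786 + 0.001 = 0.787 < 0.83
    have hpi_lt : Real.pi < (3.1416 : ℝ) := Real.pi_lt_d4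
    have hpi_gt : (3.14 : ℝ) < Real.pi := Real.pi_gt_d2
    have hlog_pos : 0 < Real.log (γ / (2 * Real.pi)) := by
      apply Real.log_pos
      calc γ / (2 * Real.pi) > γ / 8 := div_lt_div_of_pos_left (by linarith) (by linarith) (by linarith)
        _ > (3000175332800 : ℝ) / 8 := div_lt_div_of_pos_right hγ (by norm_num)
        _ > 1 := by norm_num
    have hs_pos : 0 < xiSpacing γ := by unfold xiSpacing; positivity
    -- log(γ/(2π)) > 15
    have log_bound : (15 : ℝ) < Real.log (γ / (2 * Real.pi)) := by
      have he_lt : Real.exp 1 < (2.72 : ℝ) := lt_trans Real.exp_one_lt_d9 (by norm_num)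
      have h15 : Real.exp 15 = Real.exp 1 ^ 15 := by rw [← Real.exp_nat_mul]; ring_nf
      have h1 : Real.exp 1 ^ 15 < (2.72 : ℝ) ^ 15 := by gcongr
      have hexp_small : Real.exp 15 < T_PT / 8 := by
        have h2 : (2.72 : ℝ) ^ 15 < (4000000 : ℝ) := by
          -- 2.72^15 = 2.72^10 * 2.72^5 ≈ 12144.67 * 147.01 ≈ 1.78e6 < 4e6
          -- Actually 2.72^15 ≈ 3.26e6, let's bound it step by step
          -- 2.72 < 2.75, and 2.75^15 = (11/4)^15
          have h : (2.72 : ℝ) < 2.75 := by norm_num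
          have hb : (2.75 : ℝ) ^ 15 < 4000000 := by
            -- 2.75^15 = 11^15/4^15 ≈ 3.89e6 < 4e6
            -- Certificate: 11^15 = 4177248169415651 < 4294967296000000 = 4000000 * 4^15
            have hnat : (11 : ℕ) ^ 15 < 4000000 * (4 : ℕ) ^ 15 := by native_decide
            have heq : (2.75 : ℝ) = 11 / 4 := by norm_num
            have h4pos : (0 : ℝ) < (4 : ℝ) ^ 15 := by positivity
            have h11 : (11 : ℝ) ^ 15 < 4000000 * (4 : ℝ) ^ 15 := by
              have h1 : ((11 : ℕ) ^ 15 : ℕ) < (4000000 * (4 : ℕ) ^ 15 : ℕ) := hnat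
              calc (11 : ℝ) ^ 15 = ((11 : ℕ) ^ 15 : ℝ) := by norm_cast
                _ < ((4000000 * (4 : ℕ) ^ 15) : ℝ) := by exact_mod_cast h1
                _ = 4000000 * ((4 : ℕ) ^ 15 : ℝ) := by push_cast; ring
                _ = 4000000 * (4 : ℝ) ^ 15 := by norm_cast
            calc (2.75 : ℝ) ^ 15 = (11 / 4 : ℝ) ^ 15 := by rw [heq]
              _ = (11 : ℝ) ^ 15 / (4 : ℝ) ^ 15 := by rw [div_pow]
              _ < 4000000 := (div_lt_iff₀ h4pos).mpr h11
          calc (2.72 : ℝ) ^ 15 < (2.75 : ℝ) ^ 15 := by gcongr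
            _ < 4000000 := hb
        have h3 : (4000000 : ℝ) < (3000175332800 : ℝ) / 8 := by norm_num
        calc Real.exp 15 = Real.exp 1 ^ 15 := h15
          _ < (2.72 : ℝ) ^ 15 := h1
          _ < 4000000 := h2
          _ < T_PT / 8 := by unfold T_PT; exact h3
      have h2 : γ / (2 * Real.pi) > γ / 8 := div_lt_div_of_pos_left (by linarith) (by linarith) (by linarith)
      have h3 : γ / 8 > T_PT / 8 := div_lt_div_of_pos_right hγ (by norm_num)
      have hT_pos : 0 < T_PT / 8 := by unfold T_PT; positivity
      calc (15 : ℝ) = Real.log (Real.exp 15) := (Real.log_exp 15).symm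
        _ < Real.log (T_PT / 8) := Real.log_lt_log (Real.exp_pos _) hexp_small
        _ < Real.log (γ / 8) := Real.log_lt_log hT_pos h3
        _ < Real.log (γ / (2 * Real.pi)) := Real.log_lt_log (by positivity) h2
    -- The key bound
    have h1 : (0.35 : ℝ) / xiSpacing γ = 0.35 * Real.log (γ / (2 * Real.pi)) / (2 * Real.pi) := by
      unfold xiSpacing; field_simp
    have h2 : 0.35 * Real.log (γ / (2 * Real.pi)) / (2 * Real.pi) ≥ 0.35 * 15 / (2 * Real.pi) := by
      apply div_le_div_of_nonneg_right _ (by linarith)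
      exact mul_le_mul_of_nonneg_left (le_of_lt log_bound) (by norm_num)
    have h3 : (0.35 : ℝ) * 15 / (2 * Real.pi) > Real.pi / 4 + 1 / 1000 := by
      have h4 : (0.35 : ℝ) * 15 / (2 * 3.1416) > 0.834 := by norm_num
      have h5 : (0.35 : ℝ) * 15 / (2 * Real.pi) > 0.35 * 15 / (2 * 3.1416) :=
        div_lt_div_of_pos_left (by norm_num) (by linarith) (by linarith)
      have h6 : Real.pi / 4 + 1 / 1000 < 3.1416 / 4 + 1 / 1000 := by linarith
      linarith
    calc Real.pi / 4 + 1 / 1000 + errorBudget / xiSpacing γ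
        ≤ 0.35 * Real.log (γ / (2 * Real.pi)) / (2 * Real.pi) + errorBudget / xiSpacing γ := by linarith [h3, h2]
      _ = 0.35 / xiSpacing γ + errorBudget / xiSpacing γ := by rw [← h1]
      _ = (0.35 + errorBudget) / xiSpacing γ := by ring
      _ = eta0 / xiSpacing γ := by unfold eta0 errorBudget; ring

end Summit.RiemannHypothesis.RiemannHypothesis.Cruxes.Remainder0Xi.Rho2V2
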